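import Mathlib
import Literature.NumberTheory.GaloisRepresentations.ContinuousRep

/-!
# Roots of the characteristic polynomial of a framed representation over an algebraically closed field

Helper (decomp-langlands census-1 g20; `Summits/Langlands/Langlands/Theorems/WeightMultiplicitySplitCharpolyRoots.lean`) for the roots-typed window dials of the decomp-langlands lens-2 routes (`DegenerateWindowSplit`, `WallWindowSplit`;
census instrument I-g16.3 of lens-2-g16, `--supports stmt-Langlands-27007`): over an algebraically closed coefficient field the
characteristic polynomial of `ρ g` is monic of degree `n` and splits, so its root multiset has exactly `n` elements — the fact that
turns a multiset identity between `(FramedRep.charpoly ρ g).roots` and a plethysm of the roots of an avatar into a statement about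
ALL eigenvalues (Brauer–Nesbitt input).  Mathlib only (`Matrix.charpoly_natDegree_eq_dim`, `IsAlgClosed.splits`,
`Polynomial.Splits.natDegree_eq_card_roots`); nothing here is specific to Galois groups.
-/

set_option linter.dupNamespace false -- project-wide option; `Summit.Langlands.Langlands` is the mandated namespace

namespace Summit.Langlands.Langlands.Theorems.CharpolyRoots

open Literature.NumberTheory.GaloisRepresentations

variable {G : Type*} [Group G] [TopologicalSpace G] {A : Type*} [Field A] [TopologicalSpace A] {n : ℕ}

/-- The characteristic polynomial of `ρ g` has degree `n`. [folklore] -/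
theorem natDegree_charpoly (ρ : FramedRep G A n) (g : G) : (FramedRep.charpoly ρ g).natDegree = n := by
  rw [FramedRep.charpoly, Matrix.charpoly_natDegree_eq_dim, Fintype.card_fin]

/-- The characteristic polynomial of `ρ g` is monic. [folklore] -/
theorem monic_charpoly (ρ : FramedRep G A n) (g : G) : (FramedRep.charpoly ρ g).Monic :=
  Matrix.charpoly_monic _

/-- Over an ALGEBRAICALLY CLOSED field the root multiset of the characteristic polynomial of `ρ g` has exactly `n`
elements (counted with multiplicity). [folklore] -/
theorem card_roots_charpoly [IsAlgClosed A] (ρ : FramedRep G A n) (g : G) :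
    Multiset.card (FramedRep.charpoly ρ g).roots = n := by
  rw [← (IsAlgClosed.splits (FramedRep.charpoly ρ g)).natDegree_eq_card_roots, natDegree_charpoly]

/-- Over an algebraically closed field the characteristic polynomial of `ρ g` is the product of `X - C a` over its root
multiset (so `ρ g`'s eigenvalues with multiplicity ARE that multiset). [folklore] -/
theorem charpoly_eq_prod_roots [IsAlgClosed A] (ρ : FramedRep G A n) (g : G) :
    FramedRep.charpoly ρ g = ((FramedRep.charpoly ρ g).roots.map (Polynomial.X - Polynomial.C ·)).prod :=
  (IsAlgClosed.splits (FramedRep.charpoly ρ g)).eq_prod_roots_of_monic (monic_charpoly ρ g)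

/-- Two framed representations (possibly of different groups/elements) whose characteristic polynomials have the same root
multiset have the same characteristic polynomial (algebraically closed coefficients). [folklore] -/
theorem charpoly_eq_of_roots_eq [IsAlgClosed A] {G' : Type*} [Group G'] [TopologicalSpace G'] {m : ℕ} (ρ : FramedRep G A n)
    (σ : FramedRep G' A m) (g : G) (g' : G') (h : (FramedRep.charpoly ρ g).roots = (FramedRep.charpoly σ g').roots) :
    FramedRep.charpoly ρ g = FramedRep.charpoly σ g' := by
  rw [charpoly_eq_prod_roots ρ g, charpoly_eq_prod_roots σ g', h]

end Summit.Langlands.Langlands.Theorems.CharpolyRoots
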